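import Literature.NumberTheory.Sieve.RosserSieveRecurrences
import HarnessLib

/-!
# Iwaniec's continuous models at `β = 1` (dimension `κ < 1`): regularity and the recurrences (7.3)

Topic `Literature/NumberTheory/Sieve`; complement to `RosserSieveRecurrences.lean` (Iwaniec,
*Rosser's sieve*, Acta Arith. 36 (1980), §7). There the continuity and monotonicity of the
continuous models `S_n = BetaSieve.contS κ β n`, `T^±_N = BetaSieve.contT par κ β N` and the
recurrences (7.3) in integral form are proved for `β > 1`, where the kernel
`k(t) = κ t^{κ−1} (t − 1)^{−κ}` (`BetaSieveForward.sieveKernel`) is continuous on the ranges of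
integration. For the half-dimensional sieve Iwaniec's parameter is `β_{1/2} = 1` (§7, p. 193:
"`β − 1 = 0` if `κ ≤ 1/2`"), and the first recurrence `T⁻_R(s) = ∫_s^∞ k(t) T⁺_{R−1}(t − 1) dt`,
`s ≥ β = 1`, starts at the singularity `t = 1` of the kernel, which is integrable exactly when
`κ < 1` (Greaves, *Sieves in Number Theory*, (4.2.1.5); `BetaSieveForward.intervalIntegrable_sieveKernel`).
This file proves the `β = 1`, `0 ≤ κ < 1` versions: integrability of `k` and of `k(t) φ(t − 1)` on
`[s, U]` for `s ≥ 1` (`intervalIntegrable_sieveKernel_of_one_le`,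
`intervalIntegrable_sieveKernel_mul_of_one_le`), continuity of clamped primitives of integrable
functions (`continuous_clampedIntegral_of_integrableOn`, `clampedIntegral_antitone_of_integrableOn`),
continuity and monotonicity of `S_n`, `T^±_N` at `β = 1` (`continuous_contS_one`,
`continuous_contT_one`, `contS_antitoneOn_one`, `contT_antitoneOn_one`), and (7.3) at `β = 1`
(`contS_succ_succ_eq_integral_one`, `contT_zero_succ_eq_integral_one` for `s ≥ 1`,
`contT_one_succ_eq_integral_one` for `s ≥ 2`). Used for Lemma 18 in dimension `1/2`
(`BetaSieve.Iwaniec1980_lemma18_half`).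

## References

* H. Iwaniec, *Rosser's sieve*, Acta Arith. 36 (1980), 171–202: §7, (7.1)–(7.3), p. 193.
  [IwaniecActaArith1980]
* G. Greaves, *Sieves in Number Theory*, Springer (2001), (4.2.1.5). [Greaves2001]
-/

open Filter Set MeasureTheory intervalIntegral
open scoped Topology

noncomputable section

namespace Literature.NumberTheory.Sieve

/-! ### Clamped primitives of integrable functions -/

/-- A clamped primitive `s ↦ ∫_{max(s,c)}^{max(max(s,c),d)} f` of a function integrable on `[c, d]`
is continuous on `ℝ` (the integrable version of `continuous_clampedIntegral`). [folklore] -/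
theorem continuous_clampedIntegral_of_integrableOn {f : ℝ → ℝ} {c d : ℝ} (hcd : c ≤ d)
    (hf : IntegrableOn f (Icc c d)) :
    Continuous fun s => ∫ t in (max s c)..(max (max s c) d), f t := by
  have hH : ContinuousOn (fun u => ∫ t in u..d, f t) (Icc c d) := by
    have hint : IntegrableOn f (uIcc c d) volume := by rwa [uIcc_of_le hcd]
    have h := intervalIntegral.continuousOn_primitive_interval_left hint
    rwa [uIcc_of_le hcd] at h
  have hclamp : Continuous fun s : ℝ => min (max s c) d :=
    (continuous_id.max continuous_const).min continuous_const
  have hmem : ∀ s, min (max s c) d ∈ Icc c d := fun s =>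
    ⟨le_min (le_max_right _ _) hcd, min_le_right _ _⟩
  have heq : (fun s => ∫ t in (max s c)..(max (max s c) d), f t) =
      fun s => (fun u => ∫ t in u..d, f t) (min (max s c) d) :=
    funext fun s => clampedIntegral_eq hcd s
  rw [heq]
  exact hH.comp_continuous hclamp hmem

/-- A clamped primitive of a nonnegative function integrable on `[c, d]` is non-increasing (the
integrable version of `clampedIntegral_antitone`). [folklore] -/
theorem clampedIntegral_antitone_of_integrableOn {f : ℝ → ℝ} {c d : ℝ} (hcd : c ≤ d)
    (hf : IntegrableOn f (Icc c d)) (hf0 : ∀ t ∈ Icc c d, 0 ≤ f t) :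
    Antitone fun s => ∫ t in (max s c)..(max (max s c) d), f t := by
  intro a b hab
  simp only [clampedIntegral_eq hcd]
  set u := min (max a c) d with hu
  set v := min (max b c) d with hv
  have huv : u ≤ v := min_le_min (max_le_max hab le_rfl) le_rfl
  have hcu : c ≤ u := le_min (le_max_right _ _) hcd
  have hvd : v ≤ d := min_le_right _ _
  have hint : ∀ p q, c ≤ p → p ≤ q → q ≤ d → IntervalIntegrable f volume p q := by
    intro p q hp hpq hq
    rw [intervalIntegrable_iff_integrableOn_Icc_of_le hpq]
    exact hf.mono_set (Icc_subset_Icc hp hq)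
  have hadd := intervalIntegral.integral_add_adjacent_intervals (hint u v hcu huv hvd)
    (hint v d (hcu.trans huv) hvd le_rfl)
  have h0 : 0 ≤ ∫ t in u..v, f t :=
    intervalIntegral.integral_nonneg huv fun t ht => hf0 t ⟨hcu.trans ht.1, ht.2.trans hvd⟩
  linarith

namespace BetaSieve

open BetaSieveForward (sieveKernel sieveKernel_nonneg continuousOn_sieveKernel intervalIntegrable_sieveKernel)

variable {κ : ℝ}

/-! ### Integrability of the kernel from `1` on, for `κ < 1` -/

/-- **The kernel is integrable on `[s, U]` for `s ≥ 1` when `κ < 1`** (at `t = 1` it behaves like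
`κ (t − 1)^{−κ}`; Greaves (4.2.1.5)). [cite: Greaves2001, (4.2.1.5)] -/
theorem intervalIntegrable_sieveKernel_of_one_le (hκ1 : κ < 1) {s U : ℝ} (hs : 1 ≤ s)
    (hsU : s ≤ U) : IntervalIntegrable (sieveKernel κ) volume s U := by
  have h1 : IntervalIntegrable (sieveKernel κ) volume 1 2 := by
    have h := intervalIntegrable_sieveKernel (κ := κ) (β := 1) le_rfl (fun _ => hκ1)
    norm_num at h
    exact h
  have h2 : IntervalIntegrable (sieveKernel κ) volume 2 (max U 2) := by
    refine ContinuousOn.intervalIntegrable ?_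
    rw [uIcc_of_le (le_max_right _ _)]
    exact (continuousOn_sieveKernel κ).mono fun t ht => lt_of_lt_of_le one_lt_two ht.1
  have h := h1.trans h2
  refine h.mono_set ?_
  rw [uIcc_of_le hsU, uIcc_of_le (le_trans one_le_two (le_max_right _ _))]
  exact Icc_subset_Icc hs (le_max_left _ _)

/-- Integrability of `k(t) φ(t − 1)` on `[s, U]`, `s ≥ 1`, for continuous `φ` and `κ < 1`.
[folklore] -/
theorem intervalIntegrable_sieveKernel_mul_of_one_le (hκ1 : κ < 1) {φ : ℝ → ℝ} (hφ : Continuous φ)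
    {s U : ℝ} (hs : 1 ≤ s) (hsU : s ≤ U) :
    IntervalIntegrable (fun t => sieveKernel κ t * φ (t - 1)) volume s U :=
  (intervalIntegrable_sieveKernel_of_one_le hκ1 hs hsU).mul_continuousOn
    (hφ.comp (continuous_id.sub continuous_const)).continuousOn

/-! ### Continuity and monotonicity of the continuous models at `β = 1` -/

/-- **Continuity of `S_n` at `β = 1`** for `0 ≤ κ < 1` (clamped primitives of integrable
functions). [cite: IwaniecActaArith1980, §7 (after (7.2))] -/
theorem continuous_contS_one (hκ : 0 ≤ κ) (hκ1 : κ < 1) : ∀ n : ℕ, Continuous (contS κ 1 n)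
  | 0 => by
    rw [show contS κ 1 0 = fun _ => 0 from funext fun s => contS_zero κ 1 s]
    exact continuous_const
  | 1 => by
    rw [show contS κ 1 1 = fun s => ((1:ℝ) + 1) ^ κ - (min s (1 + 1)) ^ κ from
      funext fun s => contS_one κ 1 s]
    exact continuous_const.sub
      ((Real.continuous_rpow_const hκ).comp (continuous_id.min continuous_const))
  | n + 2 => by
    have ih := continuous_contS_one hκ hκ1 (n + 1)
    have h0 := (parityShift_mem n).1
    have hcd : 1 + parityShift n ≤ 1 + n + 2 := by
      have := (parityShift_mem n).2
      have : (0 : ℝ) ≤ n := Nat.cast_nonneg n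
      linarith
    have hint : IntegrableOn (fun t => sieveKernel κ t * contS κ 1 (n + 1) (t - 1))
        (Icc (1 + parityShift n) (1 + n + 2)) := by
      have h := intervalIntegrable_sieveKernel_mul_of_one_le hκ1 ih (by linarith) hcd
      rwa [intervalIntegrable_iff_integrableOn_Icc_of_le hcd] at h
    have h := continuous_clampedIntegral_of_integrableOn hcd hint
    rw [show contS κ 1 (n + 2) = fun s =>
        ∫ t in (max s (1 + parityShift n))..(max (max s (1 + parityShift n)) (1 + n + 2)),
          sieveKernel κ t * contS κ 1 (n + 1) (t - 1) from
        funext fun s => contS_succ_succ κ 1 n s]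
    exact h

/-- The partial sums `T^±_N` are continuous at `β = 1` (`0 ≤ κ < 1`).
[cite: IwaniecActaArith1980, §7 (after (7.2))] -/
theorem continuous_contT_one (hκ : 0 ≤ κ) (hκ1 : κ < 1) (par N : ℕ) :
    Continuous (contT par κ 1 N) := by
  rw [show contT par κ 1 N = fun s => ∑ n ∈ (Finset.range (N + 1)).filter (fun n => n % 2 = par % 2),
      contS κ 1 n s from funext fun s => rfl]
  exact continuous_finsetSum _ fun n _ => continuous_contS_one hκ hκ1 n

/-- Each `S_{n+2}` is non-increasing at `β = 1` (`0 ≤ κ < 1`).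
[cite: IwaniecActaArith1980, §8 (after (8.8))] -/
theorem contS_succ_succ_antitone_one (hκ : 0 ≤ κ) (hκ1 : κ < 1) (n : ℕ) :
    Antitone (contS κ 1 (n + 2)) := by
  have h0 := (parityShift_mem n).1
  have hcd : 1 + parityShift n ≤ 1 + n + 2 := by
    have := (parityShift_mem n).2
    have : (0 : ℝ) ≤ n := Nat.cast_nonneg n
    linarith
  have hint : IntegrableOn (fun t => sieveKernel κ t * contS κ 1 (n + 1) (t - 1))
      (Icc (1 + parityShift n) (1 + n + 2)) := by
    have h := intervalIntegrable_sieveKernel_mul_of_one_le hκ1 (continuous_contS_one hκ hκ1 (n + 1))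
      (by linarith) hcd
    rwa [intervalIntegrable_iff_integrableOn_Icc_of_le hcd] at h
  have h := clampedIntegral_antitone_of_integrableOn hcd hint fun t ht =>
    mul_nonneg (sieveKernel_nonneg hκ (by linarith [ht.1]))
      (contS_nonneg hκ le_rfl (n + 1) (by linarith [ht.1]))
  rw [show contS κ 1 (n + 2) = fun s =>
      ∫ t in (max s (1 + parityShift n))..(max (max s (1 + parityShift n)) (1 + n + 2)),
        sieveKernel κ t * contS κ 1 (n + 1) (t - 1) from
      funext fun s => contS_succ_succ κ 1 n s]
  exact h

/-- `S_n` is non-increasing on `[0, ∞)` at `β = 1` (`0 ≤ κ < 1`).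
[cite: IwaniecActaArith1980, §8 (after (8.8))] -/
theorem contS_antitoneOn_one (hκ : 0 ≤ κ) (hκ1 : κ < 1) : ∀ n : ℕ, AntitoneOn (contS κ 1 n) (Ici 0)
  | 0 => fun _ _ _ _ _ => by rw [contS_zero, contS_zero]
  | 1 => by
    intro a ha b _ hab
    rw [contS_one, contS_one]
    have : (min a (1 + 1)) ^ κ ≤ (min b (1 + 1)) ^ κ :=
      Real.rpow_le_rpow (le_min ha (by norm_num)) (min_le_min hab le_rfl) hκ
    linarith
  | n + 2 => (contS_succ_succ_antitone_one hκ hκ1 n).antitoneOn _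

/-- `T^±_N` is non-increasing on `[0, ∞)` at `β = 1` (`0 ≤ κ < 1`).
[cite: IwaniecActaArith1980, §8 (after (8.8))] -/
theorem contT_antitoneOn_one (hκ : 0 ≤ κ) (hκ1 : κ < 1) (par N : ℕ) :
    AntitoneOn (contT par κ 1 N) (Ici 0) := by
  intro a ha b hb hab
  exact Finset.sum_le_sum fun n _ => contS_antitoneOn_one hκ hκ1 n ha hb hab

/-! ### The integral recurrences (7.3) at `β = 1` -/

/-- `S_{m+2}(s) = ∫_s^U k(t) S_{m+1}(t − 1) dt` for `s ≥ 1 + ε_m` and any `U ≥ max(s, m + 3)`, at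
`β = 1` (`0 ≤ κ < 1`): the printed form `∫_s^∞` of (7.1). [cite: IwaniecActaArith1980, §7 (7.1)] -/
theorem contS_succ_succ_eq_integral_one (hκ : 0 ≤ κ) (hκ1 : κ < 1) (m : ℕ) {s U : ℝ}
    (hs : 1 + parityShift m ≤ s) (hU : max s (1 + m + 2) ≤ U) :
    contS κ 1 (m + 2) s = ∫ t in s..U, sieveKernel κ t * contS κ 1 (m + 1) (t - 1) := by
  have h0 := (parityShift_mem m).1
  have hs1 : 1 ≤ s := by linarith
  have e : contS κ 1 (m + 2) s =
      ∫ t in (max s (1 + parityShift m))..(max (max s (1 + parityShift m)) (1 + m + 2)),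
        sieveKernel κ t * contS κ 1 (m + 1) (t - 1) := contS_succ_succ κ 1 m s
  rw [e, max_eq_left hs]
  refine integral_max_eq_integral_of_eq_zero (fun t ht => ?_) hU
    (intervalIntegrable_sieveKernel_mul_of_one_le hκ1 (continuous_contS_one hκ hκ1 (m + 1)) hs1
      (le_max_left _ _))
  rw [contS_eq_zero_of_le (by omega) (by push_cast; linarith), mul_zero]

/-- **(7.3), first line, at `β = 1`**: `T⁻_R(s) = ∫_s^U k(t) T⁺_{R−1}(t − 1) dt` for `s ≥ 1` (the
lower limit may be the singularity `t = 1` of the kernel), for the partial sums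
`T⁻ = contT 0 κ 1 (N + 1)`, `T⁺ = contT 1 κ 1 N` and any `U ≥ max(s, N + 2)` (`0 ≤ κ < 1`).
[cite: IwaniecActaArith1980, §7 (7.3)] -/
theorem contT_zero_succ_eq_integral_one (hκ : 0 ≤ κ) (hκ1 : κ < 1) :
    ∀ (N : ℕ) {s U : ℝ}, 1 ≤ s → max s (1 + N + 1) ≤ U →
      contT 0 κ 1 (N + 1) s = ∫ t in s..U, sieveKernel κ t * contT 1 κ 1 N (t - 1)
  | 0, s, U, hs, hU => by
    rw [contT_succ, contT_zero_right, if_neg (by omega), add_zero]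
    simp only [contT_zero_right, mul_zero, intervalIntegral.integral_zero]
  | N + 1, s, U, hs, hU => by
    have hsU : s ≤ U := (le_max_left _ _).trans hU
    have ih := contT_zero_succ_eq_integral_one hκ hκ1 N hs
      ((max_le_max le_rfl (by push_cast; linarith)).trans hU)
    rw [contT_succ, ih]
    have hsplit : ∫ t in s..U, sieveKernel κ t * contT 1 κ 1 (N + 1) (t - 1) =
        (∫ t in s..U, sieveKernel κ t * contT 1 κ 1 N (t - 1)) +
          ∫ t in s..U, sieveKernel κ t *
            (if (N + 1) % 2 = 1 % 2 then contS κ 1 (N + 1) (t - 1) else 0) := by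
      rw [← intervalIntegral.integral_add
        (intervalIntegrable_sieveKernel_mul_of_one_le hκ1 (continuous_contT_one hκ hκ1 1 N) hs hsU)]
      · refine intervalIntegral.integral_congr fun t _ => ?_
        simp only [contT_succ]
        ring
      · split_ifs
        · exact intervalIntegrable_sieveKernel_mul_of_one_le hκ1 (continuous_contS_one hκ hκ1 (N + 1))
            hs hsU
        · simp only [mul_zero]; exact intervalIntegrable_const
    rw [hsplit]
    congr 1
    by_cases hpar : (N + 1 + 1) % 2 = 0 % 2
    · have hc : (N + 1) % 2 = 1 % 2 := by omega
      rw [if_pos hpar]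
      simp only [if_pos hc]
      refine contS_succ_succ_eq_integral_one hκ hκ1 N
        (by rw [parityShift_of_even (by omega)]; linarith) (max_le hsU ?_)
      have := le_max_right s (1 + ((N : ℝ) + 1) + 1)
      push_cast at hU ⊢
      linarith
    · have hc : ¬ (N + 1) % 2 = 1 % 2 := by omega
      rw [if_neg hpar]
      simp only [if_neg hc, mul_zero, intervalIntegral.integral_zero]

/-- **(7.3), second line, at `β = 1`**: `T⁺_R(s) = ∫_s^U k(t) T⁻_R(t − 1) dt` for `s ≥ 2`, for the
partial sums `T⁺ = contT 1 κ 1 (N + 1)`, `T⁻ = contT 0 κ 1 N` and any `U ≥ max(s, N + 2)`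
(`0 ≤ κ < 1`). [cite: IwaniecActaArith1980, §7 (7.3)] -/
theorem contT_one_succ_eq_integral_one (hκ : 0 ≤ κ) (hκ1 : κ < 1) :
    ∀ (N : ℕ) {s U : ℝ}, 2 ≤ s → max s (1 + N + 1) ≤ U →
      contT 1 κ 1 (N + 1) s = ∫ t in s..U, sieveKernel κ t * contT 0 κ 1 N (t - 1)
  | 0, s, U, hs, hU => by
    rw [contT_succ, contT_zero_right, if_pos (by omega), zero_add,
      contS_eq_zero_of_le le_rfl (by push_cast; linarith)]
    simp only [contT_zero_right, mul_zero, intervalIntegral.integral_zero]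
  | N + 1, s, U, hs, hU => by
    have hs1 : 1 ≤ s := by linarith
    have hsU : s ≤ U := (le_max_left _ _).trans hU
    have ih := contT_one_succ_eq_integral_one hκ hκ1 N hs
      ((max_le_max le_rfl (by push_cast; linarith)).trans hU)
    rw [contT_succ, ih]
    have hsplit : ∫ t in s..U, sieveKernel κ t * contT 0 κ 1 (N + 1) (t - 1) =
        (∫ t in s..U, sieveKernel κ t * contT 0 κ 1 N (t - 1)) +
          ∫ t in s..U, sieveKernel κ t *
            (if (N + 1) % 2 = 0 % 2 then contS κ 1 (N + 1) (t - 1) else 0) := by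
      rw [← intervalIntegral.integral_add
        (intervalIntegrable_sieveKernel_mul_of_one_le hκ1 (continuous_contT_one hκ hκ1 0 N) hs1 hsU)]
      · refine intervalIntegral.integral_congr fun t _ => ?_
        simp only [contT_succ]
        ring
      · split_ifs
        · exact intervalIntegrable_sieveKernel_mul_of_one_le hκ1 (continuous_contS_one hκ hκ1 (N + 1))
            hs1 hsU
        · simp only [mul_zero]; exact intervalIntegrable_const
    rw [hsplit]
    congr 1
    by_cases hpar : (N + 1 + 1) % 2 = 1 % 2
    · have hc : (N + 1) % 2 = 0 % 2 := by omega
      rw [if_pos hpar]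
      simp only [if_pos hc]
      refine contS_succ_succ_eq_integral_one hκ hκ1 N
        (by rw [parityShift_of_odd (by omega)]; linarith) (max_le hsU ?_)
      have := le_max_right s (1 + ((N : ℝ) + 1) + 1)
      push_cast at hU ⊢
      linarith
    · have hc : ¬ (N + 1) % 2 = 0 % 2 := by omega
      rw [if_neg hpar]
      simp only [if_neg hc, mul_zero, intervalIntegral.integral_zero]

end BetaSieve

end Literature.NumberTheory.Sieve
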